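import Summits.BirchSwinnertonDyer.BirchSwinnertonDyer.Theorems.GoldfeldAllTwistsTwoConverseTwinQuarterTraceGalois
import Summits.BirchSwinnertonDyer.BirchSwinnertonDyer.Theorems.GoldfeldAllTwistsTwoConverseTwinHalfTraceSevenModEightHalfTrace
import Summits.BirchSwinnertonDyer.BirchSwinnertonDyer.Theorems.GoldfeldK12AdditiveTwoRamifiedHeegner
import HarnessLib

set_option linter.dupNamespace false -- namespace `…BirchSwinnertonDyer.BirchSwinnertonDyer…` is the cell's (D-0017 nested layout)
set_option autoImplicit false

/-!
# LINE C3⁺ (PHASE 2), file P2b-2: the QUARTER-TRACE CONJUGATION LAW `Ψ″ + τΨ″ = #Cl(K)² · T` in `X₀(49)(K[1])`,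
# `K = ℚ(√−2qp)` — Gross's reflection law summed over the principal genus (ty FILE D BY NAME)

Cell `bsd-goldfeld`, seat `bsd-goldfeld-s1p-c3x` (gen 7); planner ORDER (ccxxix)/(ccxxxi) «LINE C3⁺, tranche 1», file P2b, second
(mechanically split) half (first half: P2b-1 `…TwinQuarterTraceGalois`). `--supports stmt-BirchSwinnertonDyer-20044` as a HELPER.
Theses-free; theorems only (no definition, no `sorry`). NO new fact: the two named inputs are A″'s — the root number
`w(49a1) = +1` (`hw`, = `rootNumber_cm7 h12`) and the cusp value `φ₀(0) = T` (`h0`, = `x049_cuspZeroPoint_eq_twoTorsion_of_abs_eq_one_of_thm12 h12`);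
everything else is PROVED in the tree and CITED: Shimura reciprocity (ty, `exists_shimuraReciprocity_ringClassField_one`), Gross's summed
reflection law over a coset of the squares (ty FILE D `conjPoint_sum_φ_heegnerTau_sqCoset` with `[𝔫] = [𝔮₇]²`,
`heegnerFormClass_levelForm_eq_sq`), the count `#filter = #Cl²` (A″ `card_filter_sqCoset_eq_natCard_range`), the index-four genus
characterisation (P2b-1 `stab_two_sqrt_iff_symm_mem_range_sq`, P2f `index_range_sq_classGroup_QO_eq_four_negEightTwoPrimes`).

THE STATEMENT (`quarterTrace_add_map_conj_eq_negEightTwoPrimes`). `K` imaginary quadratic, `d_K = −8qp` (`q ≠ p` odd primes,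
`(q/7) = −1`, `(p/7) = +1`, so `7` splits: Heegner hypothesis at `49` by c201's `satisfiesHeegnerHypothesis_fortyNine_of_discr_eq`);
`L = K[1]`; `r_q, r_p ∈ L` with `r_q² = −q`, `r_p² = p`; `y = y(1)` the conductor-one Heegner point of a Kolyvagin–Heegner datum; `τ`
complex conjugation; `Ψ″ := Σ_{σ ∈ Gal(L/K), σ r_q = r_q ∧ σ r_p = r_p} σ y` (the sum over `Θ(Cl²)`, the principal genus). Then
**`Ψ″ + τΨ″ = #Cl(K)² • T`**, `T = (2, −1)` — the hypothesis `cΨ + Ψ = κT`, `κ = h(−8qp)/4`, of the quarter-trace core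
(P2a `quarterTrace_parity`). Proof = A″'s `halfTrace_add_map_conj_eq_zero_negEightPrime` with the coset `Cl²γ₀` replaced by `Cl²`
itself (`γ₀ = [𝔞_{q₁}]`) and the parity step replaced by keeping the torsion term `#Cl² • φ(0)`.

HONEST FRAMING: a Galois-descent identity for Heegner points; no `L`-value, no case of K12₂″ / twin″ decided; BSD is not proved.

References: B. Gross, LMS LN 153 (1991) Prop. 5.3 [GrossLMS1991]; H. Darmon, CBMS 101 (2004) Thm 3.7 [Darmon2004]; D. Cox,
*Primes of the form x² + ny²* (2013) §3.B Thm 3.15 [Cox2013].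
-/

noncomputable section

open scoped Classical

open WeierstrassCurve Literature.NumberTheory.EllipticCurves Literature.NumberTheory.EllipticCurves.ModularForms
  Literature.NumberTheory.EllipticCurves.CoatesLiTianZhai2015 Literature.Computability.Cryptography.Hallgren2005

namespace Summit.BirchSwinnertonDyer.BirchSwinnertonDyer.Theorems.GoldfeldGoodTwists

section QuarterTrace

variable {K : Type} [Field K] [NumberField K]

/-- `r² = m` read over `K` inside `K[1]` (positive twin of A″'s `sq_eq_algebraMap_neg_natCast`). [folklore] -/
theorem sq_eq_algebraMap_natCast' {ι : K →+* ℂ} {m : ℕ} {r : ringClassField K ι 1} (hr : (r : ℂ) ^ 2 = (m : ℂ)) :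
    r ^ 2 = algebraMap K (ringClassField K ι 1) (m : K) := by
  apply Subtype.ext
  rw [map_natCast]
  push_cast
  exact hr

/-- `(−2qp / 7) = +1` from `(q/7) = −1`, `(p/7) = +1` (`(−2/7) = −1`). [folklore] -/
theorem jacobiSym_neg_two_mul_mul_seven {q p : ℕ} (hq7 : jacobiSym q 7 = -1) (hp7 : jacobiSym p 7 = 1) :
    jacobiSym (-(2 * (q : ℤ) * p)) 7 = 1 := by
  rw [show (-(2 * (q : ℤ) * p)) = (-2) * ((q : ℤ) * p) by ring, jacobiSym.mul_left, jacobiSym.mul_left, hq7, hp7,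
    jacobiSym.mod_left (-2) 7]
  norm_num [jacobiSym.mod_left]

variable (ι : K →+* ℂ) [FiniteDimensional K (ringClassField K ι 1)] [IsGalois K (ringClassField K ι 1)]

/-- **THE QUARTER-TRACE CONJUGATION LAW: `Ψ″ + τΨ″ = #Cl(K)² • T`** in `X₀(49)(K[1])` for `K = ℚ(√−2qp)` (`d_K = −8qp`,
`q ≠ p` odd primes, `(q/7) = −1`, `(p/7) = +1`), `r_q = √−q`, `r_p = √p ∈ K[1]`,
`Ψ″ = Σ_{σ r_q = r_q ∧ σ r_p = r_p} σ·y(1)` the quarter trace of the conductor-one Heegner point (sum over the principal genus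
`Θ(Cl²)`), `τ` complex conjugation, `T = (2, −1)`; stated for any `DecidableEq K[1]`. Inputs BY NAME: `hw` (`w = +1`), `h0` (φ(0) = T).
[cite: GrossLMS1991, Prop. 5.3] [cite: Darmon2004, Thm. 3.7 and Prop. 3.11] [cite: Cox2013, §3.B Thm. 3.15] -/
theorem quarterTrace_add_map_conj_eq_negEightTwoPrimes (hK : IsImaginaryQuadratic K) {q p : ℕ} (hq : q.Prime) (hp : p.Prime)
    (hq2 : q ≠ 2) (hp2 : p ≠ 2) (hqp : q ≠ p) (hq7 : jacobiSym q 7 = -1) (hp7 : jacobiSym p 7 = 1)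
    (hdK : NumberField.discr K = -(8 * (q : ℤ) * p)) {N : ℕ} [NeZero N] (hN : cm7.conductorNorm ℤ = N)
    (D₀ : ModularParametrizationData cm7 N) (hw : cm7.rootNumber = 1) (h0 : ∃ h, D₀.cuspZeroPoint = Affine.Point.some 2 (-1) h)
    {β : ℤ} (d : KolyvaginHeegnerData D₀ β ι 1) {rq rp : ringClassField K ι 1} (hrq : (rq : ℂ) ^ 2 = -(q : ℂ))
    (hrp : (rp : ℂ) ^ 2 = (p : ℂ))
    (τ : ringClassField K ι 1 ≃ₐ[ℚ] ringClassField K ι 1)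
    (hτ : ∀ x : ringClassField K ι 1, ((τ x : ringClassField K ι 1) : ℂ) = starRingEnd ℂ x)
    [hdec : DecidableEq (ringClassField K ι 1)] :
    (∑ σ : ringClassField K ι 1 ≃ₐ[K] ringClassField K ι 1,
        (if σ rq = rq ∧ σ rp = rp then (1 : ℤ) else 0) •
          Affine.Point.map (σ : ringClassField K ι 1 →ₐ[K] ringClassField K ι 1) d.y) +
      Affine.Point.map (τ : ringClassField K ι 1 →ₐ[ℚ] ringClassField K ι 1)
        (∑ σ : ringClassField K ι 1 ≃ₐ[K] ringClassField K ι 1,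
          (if σ rq = rq ∧ σ rp = rp then (1 : ℤ) else 0) •
            Affine.Point.map (σ : ringClassField K ι 1 →ₐ[K] ringClassField K ι 1) d.y) =
      (Nat.card (powMonoidHom 2 : ClassGroup (OrderCl.QO hK.negDiscr) →* ClassGroup (OrderCl.QO hK.negDiscr)).range) •
        Affine.Point.some 2 (-1) (nonsingular_cm7_baseChange_two_neg_one (ringClassField K ι 1)) := by
  have hworld : hdec = fun a b ↦ Subtype.instDecidableEq a b := Subsingleton.elim _ _
  subst hworld
  subst hN
  ------------------------------------------------------------------ data: Heegner hypothesis, datum, lift family, Θ, q₁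
  have hH : SatisfiesHeegnerHypothesis (cm7.conductorNorm ℤ) K := by
    rw [conductorNorm_cm7]
    exact satisfiesHeegnerHypothesis_fortyNine_of_discr_eq K hK.1 (n := -(2 * (q : ℤ) * p)) (by rw [hdK]; ring)
      (jacobiSym_neg_two_mul_mul_seven hq7 hp7)
  have hND : ∀ p' : ℕ, p'.Prime → p' ∣ cm7.conductorNorm ℤ → ¬ (p' : ℤ) ∣ NumberField.discr K :=
    fun p' hp' hpN ↦ not_dvd_discr_of_satisfiesHeegnerHypothesis hK hH hp' hpN
  obtain ⟨H, hHβ⟩ := nonempty_heegnerDatum_holds (cm7.conductorNorm ℤ) K hK d.dvd_sq_sub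
  obtain ⟨P, Θ, hPφ, hΘ⟩ := exists_shimuraReciprocity_ringClassField_one hK hH D₀ H ι
  obtain ⟨q₁, hy⟩ := exists_rep_y_eq_of_kolyvaginHeegnerData hK d H hHβ hPφ
  choose qσ hqσ using fun σ : ringClassField K ι 1 ≃ₐ[K] ringClassField K ι 1 ↦ hΘ (Θ.symm σ) q₁
  have hqσ_map : ∀ σ : ringClassField K ι 1 ≃ₐ[K] ringClassField K ι 1,
      Affine.Point.map (σ : ringClassField K ι 1 →ₐ[K] ringClassField K ι 1) d.y = P (qσ σ) := fun σ ↦ by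
    have h := (hqσ σ).2
    rw [MulEquiv.apply_symm_apply] at h
    rw [hy]; exact h
  ------------------------------------------------------------------ the principal genus = joint stabiliser of `√−q`, `√p`
  have hrqK := sq_eq_algebraMap_neg_natCast (ι := ι) hrq
  have hrpK := sq_eq_algebraMap_natCast' (ι := ι) hrp
  have ha : ¬ IsSquare (-(q : K)) := by
    have h := not_isSquare_neg_q_of_discr_negEightTwoPrimes hK hq hp hp2 hdK
    rwa [map_neg, map_natCast] at h
  have hb : ¬ IsSquare (p : K) := by
    have h := not_isSquare_p_of_discr_negEightTwoPrimes hK hq hp hdK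
    rwa [map_natCast] at h
  have hab : ¬ IsSquare (-(q : K) * p) := by
    have h := not_isSquare_neg_qp_of_discr_negEightTwoPrimes hK hq hp hdK
    rwa [map_mul, map_neg, map_natCast, map_natCast] at h
  have hΔ : hK.negDiscr.D = -(8 * (q : ℤ) * p) := by rw [hK.negDiscr_D, hdK]
  have hidx : (powMonoidHom 2 : ClassGroup (OrderCl.QO hK.negDiscr) →* ClassGroup (OrderCl.QO hK.negDiscr)).range.index = 4 :=
    index_range_sq_classGroup_QO_eq_four_negEightTwoPrimes hK.negDiscr hq hp hq2 hp2 hqp hΔ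
  haveI : Finite (ClassGroup (OrderCl.QO hK.negDiscr)) := Finite.of_equiv _ Θ.toEquiv.symm
  have hχ : ∀ σ : ringClassField K ι 1 ≃ₐ[K] ringClassField K ι 1,
      (σ rq = rq ∧ σ rp = rp) ↔ Θ.symm σ ∈ (powMonoidHom 2 : _ →* ClassGroup (OrderCl.QO hK.negDiscr)).range :=
    stab_two_sqrt_iff_symm_mem_range_sq Θ hidx hrqK hrpK ha hb hab
  -- `σ` in the principal genus ⟺ `[𝔞_{q(σ)}] ∈ Cl² · γ₀`, `γ₀ = [𝔞_{q₁}]`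
  set γ₀ : ClassGroup (OrderCl.QO hK.negDiscr) := heegnerFormClass hK (q₁ : ℤ × ℤ × ℤ) with hγ₀
  have hcoset : ∀ σ : ringClassField K ι 1 ≃ₐ[K] ringClassField K ι 1,
      (σ rq = rq ∧ σ rp = rp) ↔ ∃ δ, heegnerFormClass hK (qσ σ : ℤ × ℤ × ℤ) = δ ^ 2 * γ₀ := fun σ ↦ by
    rw [hχ σ, (hqσ σ).1, hγ₀]
    constructor
    · rintro ⟨δ, hδ⟩
      exact ⟨δ, by rw [← hδ, powMonoidHom_apply]⟩
    · rintro ⟨δ, hδ⟩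
      exact ⟨δ, by rw [powMonoidHom_apply]; exact (mul_right_cancel hδ).symm⟩
  ------------------------------------------------------------------ the complex point of `Ψ″` is the sum over the coset `Cl²γ₀`
  have hinjq : ∀ σ σ' : ringClassField K ι 1 ≃ₐ[K] ringClassField K ι 1, qσ σ = qσ σ' → σ = σ' := by
    intro σ σ' h
    have h1 := (hqσ σ).1
    rw [h, (hqσ σ').1] at h1
    exact Θ.symm.injective (mul_right_cancel h1).symm
  have hsum : Affine.Point.map (ringClassField K ι 1).subtype.toRatAlgHom
      (∑ σ : ringClassField K ι 1 ≃ₐ[K] ringClassField K ι 1,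
        (if σ rq = rq ∧ σ rp = rp then (1 : ℤ) else 0) •
          Affine.Point.map (σ : ringClassField K ι 1 →ₐ[K] ringClassField K ι 1) d.y) =
      ∑ Q ∈ H.reps.filter (fun Q ↦ ∃ δ, heegnerFormClass hK Q = δ ^ 2 * γ₀), D₀.φ (heegnerTau Q) := by
    rw [map_sum]
    have h1 : ∀ σ : ringClassField K ι 1 ≃ₐ[K] ringClassField K ι 1,
        Affine.Point.map (ringClassField K ι 1).subtype.toRatAlgHom
          ((if σ rq = rq ∧ σ rp = rp then (1 : ℤ) else 0) •
            Affine.Point.map (σ : ringClassField K ι 1 →ₐ[K] ringClassField K ι 1) d.y) =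
        if σ rq = rq ∧ σ rp = rp then D₀.φ (heegnerTau (qσ σ : ℤ × ℤ × ℤ)) else 0 := fun σ ↦ by
      rw [map_zsmul, hqσ_map, hPφ]
      by_cases h : σ rq = rq ∧ σ rp = rp
      · rw [if_pos h, if_pos h, one_zsmul]
      · rw [if_neg h, if_neg h, zero_zsmul]
    simp_rw [h1]
    rw [← Finset.sum_filter]
    refine Finset.sum_nbij (fun σ ↦ (qσ σ : ℤ × ℤ × ℤ)) (fun σ hσ ↦ ?_) (fun σ hσ σ' hσ' h ↦ ?_) (fun Q hQ ↦ ?_)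
      (fun _ _ ↦ rfl)
    · rw [Finset.mem_filter] at hσ ⊢
      exact ⟨(qσ σ).2, (hcoset σ).mp hσ.2⟩
    · exact hinjq σ σ' (Subtype.ext h)
    · obtain ⟨hQ, δ, hδ⟩ := Finset.mem_filter.mp (Finset.mem_coe.mp hQ)
      -- the automorphism of class `δ²`
      refine ⟨Θ (δ ^ 2), Finset.mem_coe.mpr (Finset.mem_filter.mpr ⟨Finset.mem_univ _, ?_⟩), ?_⟩
      · refine (hcoset _).mpr ⟨δ, ?_⟩
        rw [(hqσ _).1, MulEquiv.symm_apply_apply, hγ₀]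
      · have hcl : heegnerFormClass hK (qσ (Θ (δ ^ 2)) : ℤ × ℤ × ℤ) = heegnerFormClass hK Q := by
          rw [(hqσ _).1, MulEquiv.symm_apply_apply, hδ, hγ₀]
        exact heegnerFormClass_injOn_reps hK H (qσ _).2 hQ hcl
  ------------------------------------------------------------------ Gross's summed reflection law on `Cl²γ₀`; the count `#Cl²`
  have hW : IsFrickeEigen (cm7.conductorNorm ℤ) D₀.f (((-1 : ℤ)) : ℂ) := by
    push_cast
    exact isFrickeEigen_neg_one_of_rootNumber_eq_one cm7 D₀.isNewformOf hw
  have hν : ∃ μ, heegnerFormClass hK ((cm7.conductorNorm ℤ : ℤ), H.β,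
      (H.β ^ 2 - NumberField.discr K) / (4 * cm7.conductorNorm ℤ)) = μ ^ 2 := by
    have h7 : cm7.conductorNorm ℤ = 7 ^ 2 := by rw [conductorNorm_cm7]; norm_num
    haveI : NeZero (7 : ℕ) := ⟨by norm_num⟩
    refine ⟨_, ((heegnerFormClass_levelForm_eq_datum hK hND H q₁.2).symm.trans
      (heegnerFormClass_levelForm_eq_sq hK h7 hND (H.mem_heegnerForms _ q₁.2).1))⟩
  have hlaw := conjPoint_sum_φ_heegnerTau_sqCoset hK hH D₀ H hW (Or.inr rfl) γ₀ hν
  have hcard : (H.reps.filter (fun Q ↦ ∃ δ, heegnerFormClass hK Q = δ ^ 2 * γ₀)).card =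
      Nat.card (powMonoidHom 2 : ClassGroup (OrderCl.QO hK.negDiscr) →* ClassGroup (OrderCl.QO hK.negDiscr)).range :=
    card_filter_sqCoset_eq_natCard_range hK hH D₀ H ι γ₀
  obtain ⟨h0', hh⟩ := h0
  have hh' : D₀.cuspZeroPoint = Affine.Point.some 2 (-1) (nonsingular_cm7_baseChange_two_neg_one ℂ) := hh
  ------------------------------------------------------------------ conclusion in `E(ℂ)`
  have hTmap : Affine.Point.map (ringClassField K ι 1).subtype.toRatAlgHom
      (Affine.Point.some 2 (-1) (nonsingular_cm7_baseChange_two_neg_one (ringClassField K ι 1))) = D₀.cuspZeroPoint := by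
    rw [hh', Affine.Point.map_some]
    congr 1
  apply Affine.Point.map_injective (f := (ringClassField K ι 1).subtype.toRatAlgHom)
  rw [map_add, map_subtype_map_conj τ hτ, hsum, hlaw, map_nsmul, hTmap, hcard, neg_one_zsmul, neg_one_zsmul]
  abel

end QuarterTrace

end Summit.BirchSwinnertonDyer.BirchSwinnertonDyer.Theorems.GoldfeldGoodTwists

end
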